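import Literature.NumberTheory.Rogawski1990.UnitFundamentalLemmaInertResiduallyRegular   -- ★ (D1) `isLocalStablyConjH_of_isConj_and_conj` (+ ★ `LocalTransfer`: `stableOrbitalIntegralRel`, `IsLocalStablyConjH`)
import Literature.NumberTheory.Automorphic.UnitOrbitalIntegralHSideGluingSum       -- ★ p840632 (L5-d2) `HSideGluingSum.finsum_mem_pair_eq_div_of_eq_parity_sums`
import HarnessLib

/-!
# The H-side of the inert unit fundamental lemma: `Φ^st(γ_H, 1_{K_H}) = Φ(⟦(γ₂, γ₁)⟧) + Φ(⟦(γ₂′, γ₁)⟧) = (q^N(q+1) − 2)∕(q − 1)` — the TWO-CLASS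
# stable sum on `H_v = U(Φ₂)(L⁺_v) × U(Φ₁)(L⁺_v)` and the HEAD SHAPE of (L5) (Flicker 1998, §6 p. 95; Rogawski 1990, Lemma 4.9.3)

Topic `NumberTheory/Rogawski1990`; namespace `Literature.NumberTheory.Rogawski1990`.  THEOREMS ONLY (no definition, no instance, no notation, no named fact,
no `sorry`).  Cell `pub/hodgecm-mathlib`, F0∕P3a road «D-N7-inert», brick **(L5) HEAD SKELETON** (B-p10 (g24), integrator per LEAD F0P3a-plan (g9) T8-40; PRE-CENSUS
bf72064b4f0257e1).  HC_CM is proved only modulo the printed citations until rung 0 closes; nothing printed is a letter here.  This file fixes the SHAPE of the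
(L5) head with the two per-class VALUES as hypotheses `h₀ h₁` — discharged in the sequel by ★ (L2)-PAIR p840404 ∘ ★ `UnitaryUnitOrbitalIntegralLatticeCount` ∘
(L5-d1) frame transport (A-p13) ∘ (L5-b) self-dual Hermite classes (B-p04) ∘ ★ (L5-a) p840624 ∘ ★ (L5-c) p840580∕p840590 — and the two-class datum `hst hnc hall`
by ★-bound (L5-e) `LocalStableClassesNonsplitRankTwo.exists_isStablyConj_not_isConj_forall_isConj_or_rankTwo` (A-p13) through §2.

THE PRINT [Flicker1998UnitaryFL, §6 p. 95]: «introduce the stable orbital integral `Φ^st_{1_{K_H}}(t₀) = Φ_H(t₁) + Φ_H(t₂)` … `= (q^N(q+1) − 2)∕(q − 1)`».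
IN-HOUSE: ★ `stableOrbitalIntegralRel st m f a = ∑ᶠ c ∈ {c | st a (out c)}, classOrbitalIntegral m f c` (★ `LocalTransfer` :106).

* §1 GENERIC (any group, any `st` containing conjugacy and stable under conjugating its second argument): if the `st`-class of `a` consists of EXACTLY TWO
  conjugacy classes — `st a a′`, `¬ IsConj a a′`, `∀ k, st a k → IsConj a k ∨ IsConj a′ k` — then `{c | st a (out c)} = {⟦a⟧, ⟦a′⟧}` and
  **`stableOrbitalIntegralRel_eq_add_of_two_classes`**: `Φ^st(a, f) = Φ(⟦a⟧, f) + Φ(⟦a′⟧, f)` (the two-class twin of ★ (D1)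
  `stableOrbitalIntegralRel_indicator_eq_classOrbitalIntegral_of_unique`).
* §2 `H_v = U(Φ₂) × U(Φ₁)`: stable conjugacy is componentwise `GL`-conjugacy (★ `IsLocalStablyConjH`); in rank ONE it is EQUALITY (`GL₁` is commutative:
  `eq_of_isStablyConj_rankOne`), so the two-class datum for `γ₂ ∈ U(Φ₂)_v` ((L5-e)'s shape: `γ₂′` stably conjugate, not conjugate, every stably conjugate
  `δ` conjugate to `γ₂` or `γ₂′`) lifts to the pair `(γ₂, γ₁), (γ₂′, γ₁)` in `H_v` (`two_classes_prod_of_two_classes_fst`).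
* §3 **HEAD SHAPE `stableOrbitalIntegralRel_indicator_eq_div_of_two_classes_of_values`**: with the two class values `Φ(⟦(γ₂, γ₁)⟧, 1_{K_H}) = S₀`,
  `Φ(⟦(γ₂′, γ₁)⟧, 1_{K_H}) = S₁` (natural numbers with `S₀ + S₁ = Σ_{j ≤ N} w(j)`, `w(0) = 1`, `w(j) = q^{j−1}(q+1)` — the EVEN and ODD gluing sums in
  either order, `even_add_odd_gluingSum_eq` ∕ `odd_add_even_gluingSum_eq`) as HYPOTHESES:
  `stableOrbitalIntegralRel (IsLocalStablyConjH L v) mH 1_{K_H} (γ₂, γ₁) = ((q^N(q+1) − 2)∕(q − 1) : ℂ)` (★ p840632; proof = an `Eq.trans` chain, no `rw` on the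
  CM-carrier goal).

## References
* [Flicker1998UnitaryFL] Y. Z. Flicker, *Elementary proof of the fundamental lemma for a unitary group*, Canad. J. Math. 50 (1998), §6 p. 95 and REMARK.
* [Rogawski1990] J. D. Rogawski, *Automorphic Representations of Unitary Groups in Three Variables* (1990), §3.1 p. 19, §4.1 (4.1.1) p. 39, §4.9 Lemma 4.9.3 p. 61.
-/

set_option autoImplicit false

noncomputable section

open MeasureTheory NumberField IsDedekindDomain Finset
open Literature.NumberTheory.Automorphic Literature.NumberTheory.Automorphic.UnitaryGroup
open Literature.AlgebraicGeometry.ShimuraVarieties (unitaryGroup)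
open scoped Matrix MatrixGroups

namespace Literature.NumberTheory.Rogawski1990

/-! ## §1 Generic: a stable class made of exactly two conjugacy classes -/

section Generic

variable {A : Type*} [Group A]

/-- The class of a conjugate of `out c` is `c`. [cite: Rogawski1990, §4.1 (4.1.1) p. 39] -/
private theorem mk_conj_out_eq' (c : ConjClasses A) (y : A) : ConjClasses.mk (y * Quotient.out c * y⁻¹) = c := by
  rw [← ConjClasses.mk_eq_mk_iff_isConj.2 (isConj_iff.2 ⟨y, rfl⟩)]
  exact Quotient.out_eq c

/-- **The set of conjugacy classes in a two-class stable class is the pair `{⟦a⟧, ⟦a′⟧}`.** [cite: Rogawski1990, §3.1 p. 19; §4.1 (4.1.1) p. 39] -/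
theorem setOf_st_out_eq_pair (st : A → A → Prop) (a a' : A) (hrefl : ∀ b : A, IsConj a b → st a b)
    (hconj : ∀ (b y : A), st a b → st a (y * b * y⁻¹)) (hst : st a a') (hall : ∀ k, st a k → IsConj a k ∨ IsConj a' k) :
    {c : ConjClasses A | st a (Quotient.out c)} = {ConjClasses.mk a, ConjClasses.mk a'} := by
  ext c
  simp only [Set.mem_setOf_eq, Set.mem_insert_iff, Set.mem_singleton_iff]
  constructor
  · intro h
    rcases hall _ h with h1 | h1
    · exact Or.inl ((Quotient.out_eq c).symm.trans (ConjClasses.mk_eq_mk_iff_isConj.2 h1.symm))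
    · exact Or.inr ((Quotient.out_eq c).symm.trans (ConjClasses.mk_eq_mk_iff_isConj.2 h1.symm))
  · rintro (rfl | rfl)
    · exact hrefl _ (ConjClasses.mk_eq_mk_iff_isConj.1 (Quotient.out_eq (ConjClasses.mk a)).symm)
    · obtain ⟨y, hy⟩ := isConj_iff.1 (ConjClasses.mk_eq_mk_iff_isConj.1 (Quotient.out_eq (ConjClasses.mk a')).symm)
      rw [← hy]
      exact hconj _ y hst

/-- **`Φ^st(a, f) = Φ(⟦a⟧, f) + Φ(⟦a′⟧, f)` when the stable class of `a` is exactly the two conjugacy classes of `a` and `a′`** (any `f`, any orbital measure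
family). [cite: Rogawski1990, §4.1 (4.1.1) p. 39] [cite: Flicker1998UnitaryFL, §6 p. 95] -/
theorem stableOrbitalIntegralRel_eq_add_of_two_classes [∀ b : A, MeasurableSpace (A ⧸ Subgroup.centralizer ({b} : Set A))]
    (st : A → A → Prop) (m : OrbitalMeasureFamily A) (f : A → ℂ) (a a' : A) (hrefl : ∀ b : A, IsConj a b → st a b)
    (hconj : ∀ (b y : A), st a b → st a (y * b * y⁻¹)) (hst : st a a') (hnc : ¬ IsConj a a') (hall : ∀ k, st a k → IsConj a k ∨ IsConj a' k) :
    stableOrbitalIntegralRel st m f a = classOrbitalIntegral m f (ConjClasses.mk a) + classOrbitalIntegral m f (ConjClasses.mk a') := by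
  rw [stableOrbitalIntegralRel_def, setOf_st_out_eq_pair st a a' hrefl hconj hst hall]
  exact finsum_mem_pair fun h => hnc (ConjClasses.mk_eq_mk_iff_isConj.1 h)

end Generic

/-! ## §2 `H_v = U(Φ₂)(L⁺_v) × U(Φ₁)(L⁺_v)`: the two-class datum lifts from the `U(Φ₂)`-component -/

section Product

variable {R : Type*} [CommRing R] (σ : R →+* R)

/-- In RANK ONE stable conjugacy is equality: `1 × 1` invertible matrices commute. [cite: Rogawski1990, §3.1 p. 19] -/
theorem eq_of_isStablyConj_rankOne (J₁ : Matrix (Fin 1) (Fin 1) R) {a b : unitaryGroup σ J₁} (h : IsStablyConj σ J₁ a b) : a = b := by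
  obtain ⟨c, hc⟩ := isConj_iff.1 h
  apply Subtype.ext
  rw [← hc]
  have hcomm : (c : GL (Fin 1) R) * (a : GL (Fin 1) R) = (a : GL (Fin 1) R) * c := by
    refine Units.ext (Matrix.ext fun i j => ?_)
    fin_cases i; fin_cases j
    simp [Units.val_mul, Matrix.mul_apply, mul_comm]
  rw [hcomm, mul_inv_cancel_right]

variable (J₂ : Matrix (Fin 2) (Fin 2) R) (J₁ : Matrix (Fin 1) (Fin 1) R)

/-- **The two-class datum on `H = U(J₂) × U(J₁)` from the one on `U(J₂)`**: if the stable class of `γ₂ ∈ U(J₂)` is `⟦γ₂⟧ ⊔ ⟦γ₂′⟧` (`γ₂′` stably conjugate, not conjugate,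
every stably conjugate `δ` conjugate to one of them — ★ (L5-e)'s head shape), then for every `γ₁ ∈ U(J₁)` the `IsStablyConjH`-class of `(γ₂, γ₁)` is
`⟦(γ₂, γ₁)⟧ ⊔ ⟦(γ₂′, γ₁)⟧` in the same sense (rank one: second components are EQUAL). [cite: Rogawski1990, §3.1 p. 19] -/
theorem two_classes_prod_of_two_classes_fst {γ₂ γ₂' : unitaryGroup σ J₂} (γ₁ : unitaryGroup σ J₁)
    (hst : IsStablyConj σ J₂ γ₂ γ₂') (hnc : ¬ IsConj γ₂ γ₂') (hall : ∀ δ : unitaryGroup σ J₂, IsStablyConj σ J₂ γ₂ δ → IsConj γ₂ δ ∨ IsConj γ₂' δ) :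
    IsStablyConjH σ J₂ J₁ (γ₂, γ₁) (γ₂', γ₁) ∧ ¬ IsConj (γ₂, γ₁) (γ₂', γ₁) ∧
      ∀ k : unitaryGroup σ J₂ × unitaryGroup σ J₁, IsStablyConjH σ J₂ J₁ (γ₂, γ₁) k → IsConj (γ₂, γ₁) k ∨ IsConj (γ₂', γ₁) k := by
  refine ⟨⟨hst, IsStablyConj.refl _⟩, fun h => hnc ?_, fun k hk => ?_⟩
  · obtain ⟨c, hc⟩ := isConj_iff.1 h
    exact isConj_iff.2 ⟨c.1, by simpa using congrArg Prod.fst hc⟩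
  · have h2 : γ₁ = k.2 := eq_of_isStablyConj_rankOne σ J₁ hk.2
    rcases hall k.1 hk.1 with h | h
    · left
      obtain ⟨c, hc⟩ := isConj_iff.1 h
      exact isConj_iff.2 ⟨(c, 1), Prod.ext (by simpa using hc) (by simpa using h2)⟩
    · right
      obtain ⟨c, hc⟩ := isConj_iff.1 h
      exact isConj_iff.2 ⟨(c, 1), Prod.ext (by simpa using hc) (by simpa using h2)⟩

end Product

/-! ## §3 The HEAD SHAPE on the CM carriers at a finite place `v` -/

section Head

variable (L : Type) [Field L] [NumberField L] [IsCMField L] (v : HeightOneSpectrum (𝓞 ↥(maximalRealSubfield L)))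
  [∀ a : (cmDatum L 2 (Matrix.of fun i j : Fin 2 => if i.val + j.val + 1 = 2 then (1 : L) else 0)).Local v ×
      (cmDatum L 1 (Matrix.of fun i j : Fin 1 => if i.val + j.val + 1 = 1 then (1 : L) else 0)).Local v,
    MeasurableSpace (((cmDatum L 2 (Matrix.of fun i j : Fin 2 => if i.val + j.val + 1 = 2 then (1 : L) else 0)).Local v ×
      (cmDatum L 1 (Matrix.of fun i j : Fin 1 => if i.val + j.val + 1 = 1 then (1 : L) else 0)).Local v) ⧸
      Subgroup.centralizer ({a} : Set ((cmDatum L 2 (Matrix.of fun i j : Fin 2 => if i.val + j.val + 1 = 2 then (1 : L) else 0)).Local v ×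
      (cmDatum L 1 (Matrix.of fun i j : Fin 1 => if i.val + j.val + 1 = 1 then (1 : L) else 0)).Local v)))]

/-- **(L5) HEAD SHAPE — `Φ^st(γ_H, 1_{K_H}) = (q^N(q+1) − 2)∕(q − 1)` FROM THE TWO CLASS VALUES.**  On `H_v = U(Φ₂)(L⁺_v) × U(Φ₁)(L⁺_v)` with ANY orbital measure
family `mH` and ANY set `K_H` (in the sequel: canonical `mH`, `K_H = U(Φ₂)(𝒪_v) ×ˢ U(Φ₁)(𝒪_v)`): if the stable class of `γ₂` in `U(Φ₂)(L⁺_v)` is the two classes of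
`γ₂, γ₂′` ((L5-e)) and the two class orbital integrals of `1_{K_H}` at `(γ₂, γ₁)`, `(γ₂′, γ₁)` are the EVEN and ODD gluing sums `Σ_{j ≤ N, j ≡ 0∕1 (2)} w(j)`
(the self-dual `γ`-stable lattice counts of the two Gram parities — (L5-b)∕(L5-d1) over ★ (L5-a)∕(L5-c)), then
`stableOrbitalIntegralRel (IsLocalStablyConjH L v) mH 1_{K_H} (γ₂, γ₁) = (q^N(q+1) − 2)∕(q − 1)` — Flicker's value. [cite: Flicker1998UnitaryFL, §6 p. 95]
[cite: Rogawski1990, §4.9 Lemma 4.9.3 p. 61; §4.1 (4.1.1) p. 39] -/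
theorem stableOrbitalIntegralRel_indicator_eq_div_of_two_classes_of_values
    (mH : OrbitalMeasureFamily ((cmDatum L 2 (Matrix.of fun i j : Fin 2 => if i.val + j.val + 1 = 2 then (1 : L) else 0)).Local v ×
      (cmDatum L 1 (Matrix.of fun i j : Fin 1 => if i.val + j.val + 1 = 1 then (1 : L) else 0)).Local v))
    (KH : Set ((cmDatum L 2 (Matrix.of fun i j : Fin 2 => if i.val + j.val + 1 = 2 then (1 : L) else 0)).Local v ×
      (cmDatum L 1 (Matrix.of fun i j : Fin 1 => if i.val + j.val + 1 = 1 then (1 : L) else 0)).Local v))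
    (γ₂ γ₂' : (cmDatum L 2 (Matrix.of fun i j : Fin 2 => if i.val + j.val + 1 = 2 then (1 : L) else 0)).Local v)
    (γ₁ : (cmDatum L 1 (Matrix.of fun i j : Fin 1 => if i.val + j.val + 1 = 1 then (1 : L) else 0)).Local v)
    (hst : IsStablyConj (conjLocal L (IsCMField.complexConj L) v)
      ((UnitaryGroup.adelicForm L 2 (Matrix.of fun i j : Fin 2 => if i.val + j.val + 1 = 2 then (1 : L) else 0)).map (UnitaryGroup.adeleToLocal L v)) γ₂ γ₂')
    (hnc : ¬ IsConj γ₂ γ₂')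
    (hall : ∀ δ, IsStablyConj (conjLocal L (IsCMField.complexConj L) v)
      ((UnitaryGroup.adelicForm L 2 (Matrix.of fun i j : Fin 2 => if i.val + j.val + 1 = 2 then (1 : L) else 0)).map (UnitaryGroup.adeleToLocal L v)) γ₂ δ → IsConj γ₂ δ ∨ IsConj γ₂' δ)
    {q : ℕ} (hq : 2 ≤ q) (N : ℕ) {S₀ S₁ : ℕ}
    (h₀ : classOrbitalIntegral mH (KH.indicator fun _ => (1 : ℂ)) (ConjClasses.mk (γ₂, γ₁)) = (S₀ : ℂ))
    (h₁ : classOrbitalIntegral mH (KH.indicator fun _ => (1 : ℂ)) (ConjClasses.mk (γ₂', γ₁)) = (S₁ : ℂ))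
    (hS : S₀ + S₁ = ∑ j ∈ range (N + 1), (if j = 0 then 1 else q ^ (j - 1) * (q + 1))) :
    stableOrbitalIntegralRel (IsLocalStablyConjH L v) mH (KH.indicator fun _ => (1 : ℂ)) (γ₂, γ₁) = ((q : ℂ) ^ N * (q + 1) - 2) / (q - 1) :=
  -- no `rw` on the CM-carrier goal: an `Eq.trans` chain down to pure arithmetic (elaboration hygiene, B-p10 (g24) 03:00Z lesson)
  (two_classes_prod_of_two_classes_fst (conjLocal L (IsCMField.complexConj L) v)
    ((UnitaryGroup.adelicForm L 2 (Matrix.of fun i j : Fin 2 => if i.val + j.val + 1 = 2 then (1 : L) else 0)).map (UnitaryGroup.adeleToLocal L v))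
    ((UnitaryGroup.adelicForm L 1 (Matrix.of fun i j : Fin 1 => if i.val + j.val + 1 = 1 then (1 : L) else 0)).map (UnitaryGroup.adeleToLocal L v))
    γ₁ hst hnc hall).elim fun hstH hrest =>
  (stableOrbitalIntegralRel_eq_add_of_two_classes (IsLocalStablyConjH L v) mH _ (γ₂, γ₁) (γ₂', γ₁) (isLocalStablyConjH_of_isConj_and_conj L (γ₂, γ₁)).1
    (isLocalStablyConjH_of_isConj_and_conj L (γ₂, γ₁)).2 hstH hrest.1 hrest.2).trans
    (((congrArg₂ (· + ·) h₀ h₁).trans (by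
      rw [← Nat.cast_add, hS]
      exact HSideGluingSum.cast_sum_gluingWeight_eq_div hq N)))

/-- The parity bookkeeping for `hS`: the EVEN and ODD gluing sums add up to the full one (either order). [cite: Flicker1998UnitaryFL, §6 p. 95] -/
theorem even_add_odd_gluingSum_eq (q N : ℕ) :
    ∑ j ∈ (range (N + 1)).filter (fun j => j % 2 = 0), (if j = 0 then 1 else q ^ (j - 1) * (q + 1)) +
        ∑ j ∈ (range (N + 1)).filter (fun j => j % 2 = 1), (if j = 0 then 1 else q ^ (j - 1) * (q + 1)) =
      ∑ j ∈ range (N + 1), (if j = 0 then 1 else q ^ (j - 1) * (q + 1)) :=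
  (HSideGluingSum.sum_gluingWeight_eq_even_add_odd q N).symm

/-- … and with the odd class first. [cite: Flicker1998UnitaryFL, §6 p. 95] -/
theorem odd_add_even_gluingSum_eq (q N : ℕ) :
    ∑ j ∈ (range (N + 1)).filter (fun j => j % 2 = 1), (if j = 0 then 1 else q ^ (j - 1) * (q + 1)) +
        ∑ j ∈ (range (N + 1)).filter (fun j => j % 2 = 0), (if j = 0 then 1 else q ^ (j - 1) * (q + 1)) =
      ∑ j ∈ range (N + 1), (if j = 0 then 1 else q ^ (j - 1) * (q + 1)) := by
  rw [add_comm]; exact even_add_odd_gluingSum_eq q N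

end Head

end Literature.NumberTheory.Rogawski1990

end
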